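import Literature.MathematicalPhysics.QuantumLattice.SectorisedIncrementBoundGradedPrescribedPlateau
import Literature.MathematicalPhysics.QuantumLattice.GrassmannEffectiveActionGradedLipschitzPrescribedDB
import HarnessLib

/-!
# The orders `≥ 2` of the sectorised single-scale INCREMENT with PRESCRIBED output legs are LIPSCHITZ in the input, GRADED and TELESCOPED,
# plateau transport (the LEVELS track): `(effAction C G − e^{Δ_C} G) − (effAction C G′ − e^{Δ_C} G′)` across the SAME slice

Topic `MathematicalPhysics/QuantumLattice`; the two-input (Lipschitz) twin of `SectorisedIncrementBoundGradedPrescribedPlateau` and the prescribed-legs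
twin of `SectorisedIncrementBoundGradedLipschitzPlateau`.  The abstract supplier is
`GrassmannEffectiveActionGradedLipschitzPrescribedDB.sum_norm_kernel_effAction_sub_gaussConv_sub_le_graded_prescribed_of_gramBounded` (two even interactions,
one output leg pinned, the output legs `j ∈ J` constrained to predicates `A j`; the inputs through a COMMON majorant family `μ̄(m′, F)` of anchored `L¹` norms with
`F` further legs constrained and a difference family `ν̄(m′, F)`; the orders `2 ≤ n < N₀` TELESCOPED — one slot carries `ν̄`, the others `μ̄` — and averaged over
the landing profiles of the constrained legs, the orders `≥ N₀` of both interactions as flat tails at `μ̄(·, 0)`).  It is read through a substitution `f` and an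
analysis map `g` with the prescription-transporting Young inequality `sum_filter_norm_kernel_map_prescribed_le` of the one-input file, and transported to the
Hubbard torus by the plateau machinery, the abstract input hypotheses being discharged from the COARSE-family prescribed sizes of `G`, `G′` and `G − G′` by
k3c2-p3's bridge `SectorisedKernelNormPrescribedBridge.sum_norm_kernel_sectorPreimage_prescribedSlots_le_of_prescribedSum_le` (Benfatto–Giuliani–Mastropietro
2006 (2.61)–(2.63), (2.66), (2.70)–(2.71a), §2.8 (2.76)–(2.84), (2.87)–(2.90), App. A3 Lemma A3.1; Gawȩdzki–Kupiainen 1985 §3).  This is the model-currency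
`(hstep)` of the dimensionless LIPSCHITZ tower (`towerBornDiff_le_law₄`) on the LEVELS track: two data sets (two volumes after transfer to a common algebra,
two cutoffs) flowing across the same covariances, known sectors inherited leg by leg.

* §1 (generic label sets) **`sum_filter_norm_kernel_map_effAction_sub_gaussConv_sub_le_graded_prescribed_of_gramBounded`** — two even inputs `Ṽ, Ṽ′` on `Γ′`
  without constant part, the SAME `C`, `f`, `g`; `A`-constrained anchored norms of `Ṽ`, `Ṽ′` at most `μ̄(m′, F)`, of `Ṽ − Ṽ′` at most `ν̄(m′, F)`;
  `θ̄ = eα‖μ̄(·,0)‖_h/κ² < 1`; then for one output leg pinned at `w″` and the legs `j ∈ J` prescribed to `P j`,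
  `Σ ‖kernel_{m+1}(map g ((effAction C V − e^{Δ_C}V) − (effAction C V′ − e^{Δ_C}V′)))(X″)‖ ≤ cr·cc^m·[mixed graded-prescribed (ν̄ in ONE slot, μ̄ in the others) + 2·tail(μ̄)]`;
* §2 (Hubbard torus) **`sum_filter_norm_sectorAnalysis_effAction_sub_gaussConv_sub_le_graded_prescribed_of_plateau`** — thin/fat input families `F, F̃`, output
  family `F′` in the plateau of `F`, parent relation `child` outside which `E(F′)S(F̃)` vanishes (at most `ρc` parents per fine label), TWO even inputs `G, G′`
  without constant part with COARSE-family prescribed sizes of `G` and `G′` at most `B̄μ m′ F` and of `G − G′` at most `B̄ν m′ F`; the same right side with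
  `μ̄(m′, F) := ρc^F·(ε_x·B̄μ m′ F)`, `ν̄(m′, F) := ρc^F·(ε_x·B̄ν m′ F)`.

Everything is proved; no definition, no named fact.  NOT here: the first order (linear: the prescribed binomial–Gram door at the input `G − G′`), the
weighted-prescribed twin, and every model constant/count.

## Sources

G. Benfatto, A. Giuliani, V. Mastropietro, Ann. Henri Poincaré 7 (2006) 809–898, (2.61)–(2.63), (2.66), (2.70)–(2.71a), §2.8 (2.76)–(2.84), (2.87)–(2.90),
App. A3 Lemma A3.1 [`BenfattoGiulianiMastropietro2006`]; W. de Siqueira Pedra, M. Salmhofer, Comm. Math. Phys. 282 (2008) 797–818, Thm 1.3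
[`PedraSalmhofer2008`]; K. Gawȩdzki, A. Kupiainen, Comm. Math. Phys. 102 (1985) 1–30, §3 [`GawedzkiKupiainen1985GrossNeveu`].
-/

noncomputable section

namespace Literature.MathematicalPhysics.QuantumLattice

open GrassmannAlgebra Finset Literature.Probability.LatticeModels
open scoped Nat

universe u

/-! ### §1 Generic label sets: the telescoped G1-L-Lip read through `(f, g)` -/

section Generic

variable {𝕜 : Type*} [RCLike 𝕜] {Γ Γ' Γ'' : Type u} [Fintype Γ] [DecidableEq Γ] [Fintype Γ'] [DecidableEq Γ']
  [Fintype Γ''] [DecidableEq Γ'']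

omit [Fintype Γ'] [DecidableEq Γ'] in
/-- Kernels of a difference. [folklore] -/
private theorem kernel_sub_eq (A B : GrassmannAlgebra 𝕜 Γ') (m : ℕ) (X : Fin m → Γ') :
    kernel 𝕜 (A - B) m X = kernel 𝕜 A m X - kernel 𝕜 B m X := by
  rw [sub_eq_add_neg, kernel_add, ← neg_one_smul 𝕜 B, kernel_smul, neg_one_mul, ← sub_eq_add_neg]

/-- Nonnegativity of the mixed graded-prescribed right side (private helper). [folklore] -/
private theorem mixedGradedPrescribedRHS_nonneg (Γ' : Type u) [Fintype Γ'] {κ α ρ : ℝ} (hκ : 0 < κ) (hα : 0 ≤ α) (hρ : 0 ≤ ρ) {m : ℕ}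
    (J : Finset (Fin (m + 1))) (Nμ Nν : ℕ → ℕ → ℝ) (hNμ0 : ∀ m' F, 0 ≤ Nμ m' F) (hNν0 : ∀ m' F, 0 ≤ Nν m' F)
    (hθ : Real.exp 1 * α * normV Γ' κ ρ (fun m' => Nμ m' 0) / κ ^ 2 < 1) (N₀ : ℕ) :
    0 ≤ ∑ n ∈ Ico 2 N₀, (κ⁻¹ ^ (m + 1) * κ⁻¹ ^ (2 * (n - 1)) * (α ^ (n - 1) * Real.exp n)) *
          ∑ δ ∈ (Fintype.piFinset fun _ : Fin n => range (Fintype.card Γ' / 2 + 1)) with m + 1 + 2 * (n - 1) ≤ ∑ a, 2 * δ a,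
            ∑ pf : J → Fin n, ((∏ j, ((2 * δ (pf j) : ℕ) : ℝ)) / ((∑ a, 2 * δ a : ℕ) : ℝ) ^ J.card) *
              ∑ a, (Real.exp 3 * κ) ^ (2 * δ a) * Nν (δ a) (univ.filter fun j : J => pf j = a).card *
                ∏ b ∈ univ.erase a, (Real.exp 3 * κ) ^ (2 * δ b) * Nμ (δ b) (univ.filter fun j : J => pf j = b).card +
        2 * (ρ⁻¹ ^ (m + 1) * (Real.exp 1 * normV Γ' κ ρ (fun m' => Nμ m' 0)) *
          (Real.exp 1 * α * normV Γ' κ ρ (fun m' => Nμ m' 0) / κ ^ 2) ^ (N₀ - 1) /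
            (1 - Real.exp 1 * α * normV Γ' κ ρ (fun m' => Nμ m' 0) / κ ^ 2)) := by
  have hV0 : 0 ≤ normV Γ' κ ρ (fun m' => Nμ m' 0) := normV_nonneg hκ.le hρ fun m' => hNμ0 m' 0
  refine add_nonneg (sum_nonneg fun n _ => mul_nonneg (by positivity) (sum_nonneg fun δ _ => sum_nonneg fun pf _ =>
    mul_nonneg (by positivity) (sum_nonneg fun a _ => mul_nonneg (mul_nonneg (by positivity) (hNν0 _ _))
      (prod_nonneg fun b _ => mul_nonneg (by positivity) (hNμ0 _ _))))) ?_
  exact mul_nonneg zero_le_two (div_nonneg (by positivity) (by linarith))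

/-- **The graded orders `≥ 2` of the increment DIFFERENCE with PRESCRIBED output legs, read through `(f, g)`, TELESCOPED** (BGM 2006 (2.61)–(2.63), (2.66),
(2.77)–(2.84), (2.87)–(2.90)): `Ṽ, Ṽ′` even without constant part on the auxiliary labels `Γ′`; `C′ = fᵀ C f` replica-Gram-bounded (`κ > 0`) with row/column
sums `≤ α`; the output legs `j ∈ J` of degree `m+1` constrained to `P j` (labels of `Γ″`), predicates `A j` on `Γ′` inherited through the matrix of `g ∘ f`
(`P j y″ ∧ (g∘f)(y″,x′) ≠ 0 ⇒ A j x′`); the inputs `Ṽ`, `Ṽ′` through their `A`-constrained anchored norms at most a COMMON `μ̄(m′, F)`, the difference `Ṽ − Ṽ′`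
at most `ν̄(m′, F)`; `θ̄ < 1`; analysis costs `(cr, cc)`; `N₀ ≥ 2`, `p ∉ J`.  Then
`Σ_{X″_p = w″, P j (X″_j) ∀ j∈J} ‖kernel_{m+1}(map g ((effAction C V − e^{Δ_C}V) − (effAction C V′ − e^{Δ_C}V′)))(X″)‖ ≤ cr·cc^m·[mixed graded-prescribed + 2·tail]`,
`V = map f Ṽ`, `V′ = map f Ṽ′` — ONE slot carries `ν̄`, the others `μ̄`. [cite: BenfattoGiulianiMastropietro2006, (2.61)-(2.63), (2.66), (2.84), (2.87)-(2.90)] -/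
theorem sum_filter_norm_kernel_map_effAction_sub_gaussConv_sub_le_graded_prescribed_of_gramBounded
    (C : Matrix Γ Γ 𝕜) (f : (Γ' → 𝕜) →ₗ[𝕜] (Γ → 𝕜)) (g : (Γ → 𝕜) →ₗ[𝕜] (Γ'' → 𝕜))
    (Vt Vt' : GrassmannAlgebra 𝕜 Γ') (hVt : Vt ∈ evenPart 𝕜 Γ') (hVt' : Vt' ∈ evenPart 𝕜 Γ') (hVt0 : constPart 𝕜 Vt = 0)
    (hVt'0 : constPart 𝕜 Vt' = 0)
    {κ : ℝ} (hκ : 0 < κ) (hGB : IsGramBoundedR ((LinearMap.toMatrix' f).transpose * C * LinearMap.toMatrix' f) κ)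
    {m : ℕ} (p : Fin (m + 1)) (J : Finset (Fin (m + 1))) (hp : p ∉ J) (P : Fin (m + 1) → Γ'' → Prop) [∀ j, DecidablePred (P j)]
    (A : Fin (m + 1) → Γ' → Bool)
    (hPA : ∀ j ∈ J, ∀ (y'' : Γ'') (x' : Γ'), P j y'' → (LinearMap.toMatrix' g * LinearMap.toMatrix' f) y'' x' ≠ 0 → A j x' = true)
    (Nμ Nν : ℕ → ℕ → ℝ) (hNμ0 : ∀ m' F, 0 ≤ Nμ m' F) (hNν0 : ∀ m' F, 0 ≤ Nν m' F)
    (hNμ : ∀ (m' : ℕ) (T : Finset (Fin (m + 1))), T ⊆ J → ∀ (ι : T → Fin (2 * m')), Function.Injective ι →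
      ∀ (t : Fin (2 * m')), (∀ j, ι j ≠ t) → ∀ a : Γ',
        ∑ Y ∈ univ.filter (fun Y : Fin (2 * m') → Γ' => Y t = a),
          ‖kernel 𝕜 Vt (2 * m') Y‖ * ∏ j : T, (if A j (Y (ι j)) = true then (1 : ℝ) else 0) ≤ Nμ m' T.card)
    (hNμ' : ∀ (m' : ℕ) (T : Finset (Fin (m + 1))), T ⊆ J → ∀ (ι : T → Fin (2 * m')), Function.Injective ι →
      ∀ (t : Fin (2 * m')), (∀ j, ι j ≠ t) → ∀ a : Γ',
        ∑ Y ∈ univ.filter (fun Y : Fin (2 * m') → Γ' => Y t = a),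
          ‖kernel 𝕜 Vt' (2 * m') Y‖ * ∏ j : T, (if A j (Y (ι j)) = true then (1 : ℝ) else 0) ≤ Nμ m' T.card)
    (hNν : ∀ (m' : ℕ) (T : Finset (Fin (m + 1))), T ⊆ J → ∀ (ι : T → Fin (2 * m')), Function.Injective ι →
      ∀ (t : Fin (2 * m')), (∀ j, ι j ≠ t) → ∀ a : Γ',
        ∑ Y ∈ univ.filter (fun Y : Fin (2 * m') → Γ' => Y t = a),
          ‖kernel 𝕜 (Vt - Vt') (2 * m') Y‖ * ∏ j : T, (if A j (Y (ι j)) = true then (1 : ℝ) else 0) ≤ Nν m' T.card)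
    {α : ℝ} (hα : 0 < α)
    (hrow : ∀ X, ∑ Y, ‖((LinearMap.toMatrix' f).transpose * C * LinearMap.toMatrix' f) X Y‖ ≤ α)
    (hcol : ∀ Y, ∑ X, ‖((LinearMap.toMatrix' f).transpose * C * LinearMap.toMatrix' f) X Y‖ ≤ α)
    {ρ : ℝ} (hρ : 0 < ρ) (hθ : Real.exp 1 * α * normV Γ' κ ρ (fun m' => Nμ m' 0) / κ ^ 2 < 1)
    {cr cc : ℝ} (hcc0 : 0 ≤ cc)
    (hrow' : ∀ X'', ∑ X', ‖(LinearMap.toMatrix' g * LinearMap.toMatrix' f) X'' X'‖ ≤ cr)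
    (hcol' : ∀ X', ∑ X'', ‖(LinearMap.toMatrix' g * LinearMap.toMatrix' f) X'' X'‖ ≤ cc)
    {N₀ : ℕ} (hN₀ : 2 ≤ N₀) (w'' : Γ'') :
    ∑ X'' ∈ univ.filter (fun X'' : Fin (m + 1) → Γ'' => X'' p = w'' ∧ ∀ j ∈ J, P j (X'' j)),
        ‖kernel 𝕜 (ExteriorAlgebra.map g
          ((effAction 𝕜 C (ExteriorAlgebra.map f Vt) - gaussConv 𝕜 C (ExteriorAlgebra.map f Vt)) -
            (effAction 𝕜 C (ExteriorAlgebra.map f Vt') - gaussConv 𝕜 C (ExteriorAlgebra.map f Vt')))) (m + 1) X''‖ ≤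
      cr * cc ^ m *
        (∑ n ∈ Ico 2 N₀, (κ⁻¹ ^ (m + 1) * κ⁻¹ ^ (2 * (n - 1)) * (α ^ (n - 1) * Real.exp n)) *
            ∑ δ ∈ (Fintype.piFinset fun _ : Fin n => range (Fintype.card Γ' / 2 + 1)) with m + 1 + 2 * (n - 1) ≤ ∑ a, 2 * δ a,
              ∑ pf : J → Fin n, ((∏ j, ((2 * δ (pf j) : ℕ) : ℝ)) / ((∑ a, 2 * δ a : ℕ) : ℝ) ^ J.card) *
                ∑ a, (Real.exp 3 * κ) ^ (2 * δ a) * Nν (δ a) (univ.filter fun j : J => pf j = a).card *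
                  ∏ b ∈ univ.erase a, (Real.exp 3 * κ) ^ (2 * δ b) * Nμ (δ b) (univ.filter fun j : J => pf j = b).card +
          2 * (ρ⁻¹ ^ (m + 1) * (Real.exp 1 * normV Γ' κ ρ (fun m' => Nμ m' 0)) *
            (Real.exp 1 * α * normV Γ' κ ρ (fun m' => Nμ m' 0) / κ ^ 2) ^ (N₀ - 1) /
              (1 - Real.exp 1 * α * normV Γ' κ ρ (fun m' => Nμ m' 0) / κ ^ 2))) := by
  set C' : Matrix Γ' Γ' 𝕜 := (LinearMap.toMatrix' f).transpose * C * LinearMap.toMatrix' f with hC'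
  -- the difference hypothesis in the `kernel V − kernel V′` form of the abstract supplier
  have hNν' : ∀ (m' : ℕ) (T : Finset (Fin (m + 1))), T ⊆ J → ∀ (ι : T → Fin (2 * m')), Function.Injective ι →
      ∀ (t : Fin (2 * m')), (∀ j, ι j ≠ t) → ∀ a : Γ',
        ∑ Y ∈ univ.filter (fun Y : Fin (2 * m') → Γ' => Y t = a),
          ‖kernel 𝕜 Vt (2 * m') Y - kernel 𝕜 Vt' (2 * m') Y‖ * ∏ j : T, (if A j (Y (ι j)) = true then (1 : ℝ) else 0) ≤ Nν m' T.card := by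
    intro m' T hT ι hι t ht a
    simpa only [kernel_sub_eq] using hNν m' T hT ι hι t ht a
  -- G1-L-Lip in the auxiliary representation, for every pin
  have hK : ∀ a : Γ', ∑ W ∈ univ.filter (fun W : Fin (m + 1) → Γ' => W p = a ∧ ∀ j ∈ J, A j (W j) = true),
      ‖kernel 𝕜 ((effAction 𝕜 C' Vt - gaussConv 𝕜 C' Vt) - (effAction 𝕜 C' Vt' - gaussConv 𝕜 C' Vt')) (m + 1) W‖ ≤ _ :=
    fun a => sum_norm_kernel_effAction_sub_gaussConv_sub_le_graded_prescribed_of_gramBounded C' hκ hGB Vt Vt' hVt hVt' hVt0 hVt'0 J A Nμ Nν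
      hNμ0 hNν0 hNμ hNμ' hNν' hα hrow hcol hρ hθ hN₀ (Nat.succ_pos m) p hp a
  have hB0 := mixedGradedPrescribedRHS_nonneg Γ' hκ hα.le hρ.le J Nμ Nν hNμ0 hNν0 hθ N₀
  -- read through `g ∘ f`
  have hsub : (effAction 𝕜 C (ExteriorAlgebra.map f Vt) - gaussConv 𝕜 C (ExteriorAlgebra.map f Vt)) -
      (effAction 𝕜 C (ExteriorAlgebra.map f Vt') - gaussConv 𝕜 C (ExteriorAlgebra.map f Vt')) =
      ExteriorAlgebra.map f ((effAction 𝕜 C' Vt - gaussConv 𝕜 C' Vt) - (effAction 𝕜 C' Vt' - gaussConv 𝕜 C' Vt')) := by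
    rw [effAction_map 𝕜 f C Vt, gaussConv_map 𝕜 f C Vt, effAction_map 𝕜 f C Vt', gaussConv_map 𝕜 f C Vt', map_sub, map_sub,
      map_sub]
  rw [hsub, map_map_eq_map_comp]
  exact sum_filter_norm_kernel_map_prescribed_le (g ∘ₗ f) hcc0
    (by intro X''; rw [LinearMap.toMatrix'_comp]; exact hrow' X'')
    (by intro X'; simp only [LinearMap.toMatrix'_comp]; exact hcol' X')
    ((effAction 𝕜 C' Vt - gaussConv 𝕜 C' Vt) - (effAction 𝕜 C' Vt' - gaussConv 𝕜 C' Vt')) m p J P A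
    (by intro j hj y'' x' hPj hne; rw [LinearMap.toMatrix'_comp] at hne; exact hPA j hj y'' x' hPj hne) hB0 hK w''

end Generic

/-! ### §2 The Hubbard torus: plateau transfer, the abstract inputs discharged from the coarse-family prescribed sizes of `G`, `G′`, `G − G′` -/

section Transfer

variable {L M : ℕ} [NeZero L] {N N' : ℕ}

/-- The sector preimage is additive in `G` (private helper). [folklore] -/
private theorem sectorPreimage_add' (β : ℝ) (F : Fin N → FreqMomentum L M → ℂ) (G G' : HubbardGrassmann L M) :
    sectorPreimage β F (G + G') = sectorPreimage β F G + sectorPreimage β F G' := by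
  unfold sectorPreimage
  rw [← sum_add_distrib]
  refine sum_congr rfl fun m _ => ?_
  rw [← presented_add]
  congr 1
  funext Y
  simp only [Pi.add_apply, sectorisedKernel_add, mul_add]

/-- The sector preimage is homogeneous in `G` (private helper). [folklore] -/
private theorem sectorPreimage_smul' (β : ℝ) (F : Fin N → FreqMomentum L M → ℂ) (c : ℂ) (G : HubbardGrassmann L M) :
    sectorPreimage β F (c • G) = c • sectorPreimage β F G := by
  unfold sectorPreimage
  rw [smul_sum]
  refine sum_congr rfl fun m _ => ?_
  rw [← presented_smul]
  congr 1
  funext Y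
  simp only [Pi.smul_apply, sectorisedKernel_smul, smul_eq_mul]
  ring

/-- The sector preimage of a difference (private helper). [folklore] -/
private theorem sectorPreimage_sub' (β : ℝ) (F : Fin N → FreqMomentum L M → ℂ) (G G' : HubbardGrassmann L M) :
    sectorPreimage β F (G - G') = sectorPreimage β F G - sectorPreimage β F G' := by
  rw [sub_eq_add_neg, ← neg_one_smul ℂ G', sectorPreimage_add', sectorPreimage_smul', neg_one_smul, ← sub_eq_add_neg]

omit [NeZero L] in
/-- Expanding a product of set-membership indicators over the choices: `∏_{j} [v j ∈ P j] = Σ_{s ∈ Π_j P j} ∏_j [v j = s j]` (private helper). [folklore] -/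
private theorem prod_ite_mem_eq_sum_prod_ite_eq' {ι₀ S : Type*} [Fintype ι₀] [DecidableEq ι₀] [DecidableEq S] (Par : ι₀ → Finset S)
    (v : ι₀ → S) :
    (∏ j, (if v j ∈ Par j then (1 : ℝ) else 0)) = ∑ s ∈ Fintype.piFinset Par, ∏ j, (if v j = s j then (1 : ℝ) else 0) := by
  have h : ∀ j, (if v j ∈ Par j then (1 : ℝ) else 0) = ∑ y ∈ Par j, (if v j = y then (1 : ℝ) else 0) := fun j => by
    rw [Finset.sum_ite_eq]
  simp_rw [h]
  exact Finset.prod_univ_sum (fun j => Par j) (fun j y => if v j = y then (1 : ℝ) else 0)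

variable [NeZero M]

omit [NeZero M] in
/-- **The abstract prescribed input hypothesis of the preimage, from the COARSE-family prescribed sizes** (BGM 2006 §2.8 (2.82)–(2.84), (2.88)–(2.90), App. A3
Lemma A3.1; private helper shared by the three inputs `G`, `G′`, `G − G′`): if for every degree `2m′ ≥ 2`, every leg set `E ∋ q` with `|E| = F + 1` and every
prescription `τ`, `ε_x^{2m′−1} Σ_{σ′|_E = τ|_E} Σ_{x′_q = y} ‖W_{F,σ′}(x′)‖ ≤ B m′ F`, then the anchored norms of `kernel (sectorPreimage β F X)` with the slots
`j ∈ T` constrained to the PARENTS of the fine labels `τ″ j` (at most `ρc` parents each) are at most `ρc^{|T|}·(ε_x·B m′ |T|)`. [folklore] -/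
private theorem prescribedInput_sectorPreimage_of_coarseSizes {β : ℝ} (hβ : 0 < β) (F : Fin N → FreqMomentum L M → ℂ) (X : HubbardGrassmann L M)
    (child : Fin N' → Fin N → Prop) [DecidableRel child] {ρc : ℝ}
    (hρc : ∀ ℓ'' : SectorLeg N',
      (((univ.filter fun ℓ' : SectorLeg N => child ℓ''.1.1 ℓ'.1.1 ∧ ℓ'.1.2 = ℓ''.1.2 ∧ ℓ'.2 = ℓ''.2).card : ℝ)) ≤ ρc)
    (B : ℕ → ℕ → ℝ) (hB0 : ∀ m' Fc, 0 ≤ B m' Fc)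
    (hB : ∀ (m' Fc : ℕ) (E : Finset (Fin (2 * m' + 1 + 1))) (τ : Fin (2 * m' + 1 + 1) → SectorLeg N) (q : Fin (2 * m' + 1 + 1)),
      q ∈ E → E.card = Fc + 1 → ∀ y : SpaceTimeIdx L M,
        imagTimeWeight β M ^ (2 * m' + 1) *
          ∑ σ ∈ univ.filter (fun σ : Fin (2 * m' + 1 + 1) → SectorLeg N => ∀ e ∈ E, σ e = τ e),
            ∑ x ∈ univ.filter (fun x : Fin (2 * m' + 1 + 1) → SpaceTimeIdx L M => x q = y),
              ‖sectorisedKernel L M β F X (2 * m' + 1 + 1) σ x‖ ≤ B (m' + 1) Fc)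
    {m : ℕ} (J : Finset (Fin (m + 1))) (τ'' : Fin (m + 1) → SectorLeg N') :
    ∀ (m' : ℕ) (T : Finset (Fin (m + 1))), T ⊆ J → ∀ (ι : T → Fin (2 * m')), Function.Injective ι →
      ∀ (t : Fin (2 * m')), (∀ j, ι j ≠ t) → ∀ a : SpaceTimeIdx L M × SectorLeg N,
        ∑ Y ∈ univ.filter (fun Y : Fin (2 * m') → SpaceTimeIdx L M × SectorLeg N => Y t = a),
          ‖kernel ℂ (sectorPreimage β F X) (2 * m') Y‖ *
            ∏ j : T, (if decide ((Y (ι j)).2 ∈ univ.filter fun ℓ' : SectorLeg N =>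
                child (τ'' j).1.1 ℓ'.1.1 ∧ ℓ'.1.2 = (τ'' j).1.2 ∧ ℓ'.2 = (τ'' j).2) = true then (1 : ℝ) else 0) ≤
          ρc ^ T.card * (imagTimeWeight β M * B m' T.card) := by
  classical
  have hε : 0 ≤ imagTimeWeight β M := imagTimeWeight_nonneg hβ.le M
  intro m' T _
  rcases m' with _ | m'
  · intro ι _ t
    exact Fin.elim0 (Fin.cast (Nat.mul_zero 2) t)
  · rw [show 2 * (m' + 1) = 2 * m' + 1 + 1 by ring]
    intro ι hι t ht a
    -- the parent sets of the prescribed fine labels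
    set Par : T → Finset (SectorLeg N) := fun j => univ.filter fun ℓ' : SectorLeg N =>
      child (τ'' j).1.1 ℓ'.1.1 ∧ ℓ'.1.2 = (τ'' j).1.2 ∧ ℓ'.2 = (τ'' j).2 with hPar
    -- rewrite the inherited indicator as a sum over parent choices
    have hind : ∀ Y : Fin (2 * m' + 1 + 1) → SpaceTimeIdx L M × SectorLeg N,
        (∏ j : T, (if decide ((Y (ι j)).2 ∈ univ.filter fun ℓ' : SectorLeg N =>
            child (τ'' j).1.1 ℓ'.1.1 ∧ ℓ'.1.2 = (τ'' j).1.2 ∧ ℓ'.2 = (τ'' j).2) = true then (1 : ℝ) else 0)) =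
          ∑ s ∈ Fintype.piFinset Par, ∏ j : T, (if (Y (ι j)).2 = s j then (1 : ℝ) else 0) := by
      intro Y
      rw [← prod_ite_mem_eq_sum_prod_ite_eq' Par (fun j : T => (Y (ι j)).2)]
      refine prod_congr rfl fun j _ => ?_
      simp only [hPar, decide_eq_true_eq]
    simp_rw [hind, mul_sum]
    rw [sum_comm]
    -- each parent choice is a single-label prescription: the bridge
    have hone : ∀ s ∈ Fintype.piFinset Par,
        ∑ Y ∈ univ.filter (fun Y : Fin (2 * m' + 1 + 1) → SpaceTimeIdx L M × SectorLeg N => Y t = a),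
          ‖kernel ℂ (sectorPreimage β F X) (2 * m' + 1 + 1) Y‖ * ∏ j : T, (if (Y (ι j)).2 = s j then (1 : ℝ) else 0) ≤
          imagTimeWeight β M * B (m' + 1) T.card := fun s _ =>
      sum_norm_kernel_sectorPreimage_prescribedSlots_le_of_prescribedSum_le hβ.le F X (2 * m' + 1) (Fc := T.card)
        (B := B (m' + 1) T.card) (fun E τ q hq hE y => hB m' T.card E τ q hq hE y) T rfl ι hι t ht s a
    refine (sum_le_sum hone).trans ?_
    rw [sum_const, nsmul_eq_mul, Fintype.card_piFinset]
    have hcard : ((∏ j : T, (Par j).card : ℕ) : ℝ) ≤ ρc ^ T.card := by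
      rw [Nat.cast_prod, ← Fintype.card_coe T, ← Finset.card_univ, ← prod_const]
      exact prod_le_prod (fun j _ => Nat.cast_nonneg _) fun j _ => hρc (τ'' j)
    exact mul_le_mul_of_nonneg_right hcard (mul_nonneg hε (hB0 _ _))

/-- **The orders `≥ 2` of the increment DIFFERENCE of the sectorised kernels of two inputs across one slice, GRADED, TELESCOPED, with PRESCRIBED output legs —
the LEVELS track** (BGM 2006 (2.61)–(2.63), (2.66), §2.8 (2.82)–(2.84), (2.87)–(2.90), App. A3 Lemma A3.1; Gawȩdzki–Kupiainen 1985 §3).  Data: thin/fat input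
families `F, F̃` (`F̃F = F`, `ΣF = 0 ⇒ F = 0`), output family `F′` in the plateau of `F` over `supp C` and over `F′`; a relation `child` on sector indices such that
the overlap matrix `E(F′)S(F̃)` vanishes unless the coarse label is a PARENT of the fine one (at most `ρc` parents per fine label); TWO even inputs `G, G′` without
constant part whose COARSE-family prescribed sizes are bounded by a COMMON `B̄μ m′ F` (for every degree `2m′ ≥ 2`, leg set `E ∋ q` with `|E| = F + 1`, prescription
`τ`: `ε_x^{2m′−1} Σ_{σ′|_E = τ|_E} Σ_{x′_q = y} ‖W_{F,σ′}(x′)‖ ≤ B̄μ m′ F` for `G` and for `G′`) and those of `G − G′` by `B̄ν m′ F`; the sectorised covariance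
`S(F̃)ᵀ C S(F̃)` replica-Gram-bounded (`κ > 0`) with row/column sums `≤ α`; `θ̄ < 1` for the profile `m′ ↦ ρc⁰·(ε_x·B̄μ m′ 0)`; overlap costs `(cr, cc)`; `N₀ ≥ 2`;
output degree `m + 1`, leg `p` pinned at `w″`, legs `j ∈ J` (`p ∉ J`) prescribed to the fine labels `τ″ j`.  Then
`Σ_{X″_p = w″, (X″_j).2 = τ″_j ∀ j∈J} ‖kernel (map (toLin' E(F′)) ((effAction C G − e^{Δ_C}G) − (effAction C G′ − e^{Δ_C}G′))) (m+1) X″‖ ≤ cr·cc^m·[mixed graded-prescribed + 2·tail]`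
with `μ̄(m′, F) := ρc^F·(ε_x·B̄μ m′ F)` in all slots but ONE, which carries `ν̄(m′, F) := ρc^F·(ε_x·B̄ν m′ F)` — the Lipschitz constant of the orders `≥ 2` on the
levels track keeps the leg constraint and the known sectors. [cite: BenfattoGiulianiMastropietro2006, (2.61)-(2.63), (2.66), (2.84), (2.87)-(2.90), App. A3 Lemma A3.1] -/
theorem sum_filter_norm_sectorAnalysis_effAction_sub_gaussConv_sub_le_graded_prescribed_of_plateau
    {β : ℝ} (hβ : 0 < β) (F Ft : Fin N → FreqMomentum L M → ℂ) (hFF : ∀ ω k, Ft ω k * F ω k = F ω k)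
    (hF0 : ∀ k, ∑ ω, F ω k = 0 → ∀ ω, F ω k = 0)
    (F' : Fin N' → FreqMomentum L M → ℂ) (G G' : HubbardGrassmann L M) (hG : G ∈ evenPart ℂ (HubbardFieldIdx L M))
    (hG' : G' ∈ evenPart ℂ (HubbardFieldIdx L M)) (hG0 : constPart ℂ G = 0) (hG'0 : constPart ℂ G' = 0)
    (C : Matrix (HubbardFieldIdx L M) (HubbardFieldIdx L M) ℂ)
    (hCpl : ∀ X Y, C X Y ≠ 0 → ∑ ω, F ω X.1.1 = 1 ∧ ∑ ω, F ω Y.1.1 = 1)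
    (hF'pl : ∀ (ω' : Fin N') (k : FreqMomentum L M), F' ω' k ≠ 0 → ∑ ω, F ω k = 1)
    (child : Fin N' → Fin N → Prop) [DecidableRel child]
    (hvan : ∀ (X'' : SpaceTimeIdx L M × SectorLeg N') (X' : SpaceTimeIdx L M × SectorLeg N),
      (sectorAnalysisMatrix L M β F' * sectorSubMatrix L M β Ft) X'' X' ≠ 0 →
        child X''.2.1.1 X'.2.1.1 ∧ X'.2.1.2 = X''.2.1.2 ∧ X'.2.2 = X''.2.2)
    {ρc : ℝ} (hρc0 : 0 ≤ ρc)
    (hρc : ∀ ℓ'' : SectorLeg N',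
      (((univ.filter fun ℓ' : SectorLeg N => child ℓ''.1.1 ℓ'.1.1 ∧ ℓ'.1.2 = ℓ''.1.2 ∧ ℓ'.2 = ℓ''.2).card : ℝ)) ≤ ρc)
    {κ : ℝ} (hκ : 0 < κ)
    (hGB : IsGramBoundedR ((sectorSubMatrix L M β Ft).transpose * C * sectorSubMatrix L M β Ft) κ)
    (Bμ Bν : ℕ → ℕ → ℝ) (hBμ0 : ∀ m' Fc, 0 ≤ Bμ m' Fc) (hBν0 : ∀ m' Fc, 0 ≤ Bν m' Fc)
    (hBμ : ∀ (m' Fc : ℕ) (E : Finset (Fin (2 * m' + 1 + 1))) (τ : Fin (2 * m' + 1 + 1) → SectorLeg N) (q : Fin (2 * m' + 1 + 1)),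
      q ∈ E → E.card = Fc + 1 → ∀ y : SpaceTimeIdx L M,
        imagTimeWeight β M ^ (2 * m' + 1) *
          ∑ σ ∈ univ.filter (fun σ : Fin (2 * m' + 1 + 1) → SectorLeg N => ∀ e ∈ E, σ e = τ e),
            ∑ x ∈ univ.filter (fun x : Fin (2 * m' + 1 + 1) → SpaceTimeIdx L M => x q = y),
              ‖sectorisedKernel L M β F G (2 * m' + 1 + 1) σ x‖ ≤ Bμ (m' + 1) Fc)
    (hBμ' : ∀ (m' Fc : ℕ) (E : Finset (Fin (2 * m' + 1 + 1))) (τ : Fin (2 * m' + 1 + 1) → SectorLeg N) (q : Fin (2 * m' + 1 + 1)),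
      q ∈ E → E.card = Fc + 1 → ∀ y : SpaceTimeIdx L M,
        imagTimeWeight β M ^ (2 * m' + 1) *
          ∑ σ ∈ univ.filter (fun σ : Fin (2 * m' + 1 + 1) → SectorLeg N => ∀ e ∈ E, σ e = τ e),
            ∑ x ∈ univ.filter (fun x : Fin (2 * m' + 1 + 1) → SpaceTimeIdx L M => x q = y),
              ‖sectorisedKernel L M β F G' (2 * m' + 1 + 1) σ x‖ ≤ Bμ (m' + 1) Fc)
    (hBν : ∀ (m' Fc : ℕ) (E : Finset (Fin (2 * m' + 1 + 1))) (τ : Fin (2 * m' + 1 + 1) → SectorLeg N) (q : Fin (2 * m' + 1 + 1)),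
      q ∈ E → E.card = Fc + 1 → ∀ y : SpaceTimeIdx L M,
        imagTimeWeight β M ^ (2 * m' + 1) *
          ∑ σ ∈ univ.filter (fun σ : Fin (2 * m' + 1 + 1) → SectorLeg N => ∀ e ∈ E, σ e = τ e),
            ∑ x ∈ univ.filter (fun x : Fin (2 * m' + 1 + 1) → SpaceTimeIdx L M => x q = y),
              ‖sectorisedKernel L M β F (G - G') (2 * m' + 1 + 1) σ x‖ ≤ Bν (m' + 1) Fc)
    {α : ℝ} (hα : 0 < α)
    (hrow : ∀ X, ∑ Y, ‖((sectorSubMatrix L M β Ft).transpose * C * sectorSubMatrix L M β Ft) X Y‖ ≤ α)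
    (hcol : ∀ Y, ∑ X, ‖((sectorSubMatrix L M β Ft).transpose * C * sectorSubMatrix L M β Ft) X Y‖ ≤ α)
    {ρ : ℝ} (hρ : 0 < ρ)
    (hθ : Real.exp 1 * α * normV (SpaceTimeIdx L M × SectorLeg N) κ ρ
      (fun m' => ρc ^ 0 * (imagTimeWeight β M * Bμ m' 0)) / κ ^ 2 < 1)
    {cr cc : ℝ} (hcc0 : 0 ≤ cc)
    (hrow' : ∀ X'', ∑ X', ‖(sectorAnalysisMatrix L M β F' * sectorSubMatrix L M β Ft) X'' X'‖ ≤ cr)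
    (hcol' : ∀ X', ∑ X'', ‖(sectorAnalysisMatrix L M β F' * sectorSubMatrix L M β Ft) X'' X'‖ ≤ cc)
    {N₀ : ℕ} (hN₀ : 2 ≤ N₀) {m : ℕ} (p : Fin (m + 1)) (J : Finset (Fin (m + 1))) (hp : p ∉ J) (τ'' : Fin (m + 1) → SectorLeg N')
    (w'' : SpaceTimeIdx L M × SectorLeg N') :
    ∑ X'' ∈ univ.filter (fun X'' : Fin (m + 1) → SpaceTimeIdx L M × SectorLeg N' => X'' p = w'' ∧ ∀ j ∈ J, (X'' j).2 = τ'' j),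
        ‖kernel ℂ (ExteriorAlgebra.map (Matrix.toLin' (sectorAnalysisMatrix L M β F'))
          ((effAction ℂ C G - gaussConv ℂ C G) - (effAction ℂ C G' - gaussConv ℂ C G'))) (m + 1) X''‖ ≤
      cr * cc ^ m *
        (∑ n ∈ Ico 2 N₀, (κ⁻¹ ^ (m + 1) * κ⁻¹ ^ (2 * (n - 1)) * (α ^ (n - 1) * Real.exp n)) *
            ∑ δ ∈ (Fintype.piFinset fun _ : Fin n => range (Fintype.card (SpaceTimeIdx L M × SectorLeg N) / 2 + 1)) with
                m + 1 + 2 * (n - 1) ≤ ∑ a, 2 * δ a,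
              ∑ pf : J → Fin n, ((∏ j, ((2 * δ (pf j) : ℕ) : ℝ)) / ((∑ a, 2 * δ a : ℕ) : ℝ) ^ J.card) *
                ∑ a, (Real.exp 3 * κ) ^ (2 * δ a) *
                    (ρc ^ (univ.filter fun j : J => pf j = a).card *
                      (imagTimeWeight β M * Bν (δ a) (univ.filter fun j : J => pf j = a).card)) *
                  ∏ b ∈ univ.erase a, (Real.exp 3 * κ) ^ (2 * δ b) *
                    (ρc ^ (univ.filter fun j : J => pf j = b).card *
                      (imagTimeWeight β M * Bμ (δ b) (univ.filter fun j : J => pf j = b).card)) +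
          2 * (ρ⁻¹ ^ (m + 1) *
              (Real.exp 1 * normV (SpaceTimeIdx L M × SectorLeg N) κ ρ (fun m' => ρc ^ 0 * (imagTimeWeight β M * Bμ m' 0))) *
            (Real.exp 1 * α * normV (SpaceTimeIdx L M × SectorLeg N) κ ρ (fun m' => ρc ^ 0 * (imagTimeWeight β M * Bμ m' 0)) / κ ^ 2) ^
              (N₀ - 1) /
            (1 - Real.exp 1 * α * normV (SpaceTimeIdx L M × SectorLeg N) κ ρ (fun m' => ρc ^ 0 * (imagTimeWeight β M * Bμ m' 0)) /
              κ ^ 2))) := by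
  classical
  have hε : 0 ≤ imagTimeWeight β M := imagTimeWeight_nonneg hβ.le M
  -- the inherited predicates: the slot `j` lands on a PARENT of the fine label `τ″ j`
  set A : Fin (m + 1) → SpaceTimeIdx L M × SectorLeg N → Bool := fun j X' =>
    decide (X'.2 ∈ univ.filter fun ℓ' : SectorLeg N =>
      child (τ'' j).1.1 ℓ'.1.1 ∧ ℓ'.1.2 = (τ'' j).1.2 ∧ ℓ'.2 = (τ'' j).2) with hA
  set Nμ : ℕ → ℕ → ℝ := fun m' Fc => ρc ^ Fc * (imagTimeWeight β M * Bμ m' Fc) with hNμ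
  set Nν : ℕ → ℕ → ℝ := fun m' Fc => ρc ^ Fc * (imagTimeWeight β M * Bν m' Fc) with hNν
  have hNμ0 : ∀ m' Fc, 0 ≤ Nμ m' Fc := fun m' Fc => mul_nonneg (pow_nonneg hρc0 _) (mul_nonneg hε (hBμ0 _ _))
  have hNν0 : ∀ m' Fc, 0 ≤ Nν m' Fc := fun m' Fc => mul_nonneg (pow_nonneg hρc0 _) (mul_nonneg hε (hBν0 _ _))
  -- the abstract input hypotheses for the preimages of `G`, `G′` and `G − G′`
  have hNG := prescribedInput_sectorPreimage_of_coarseSizes hβ F G child hρc Bμ hBμ0 hBμ J τ''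
  have hNG' := prescribedInput_sectorPreimage_of_coarseSizes hβ F G' child hρc Bμ hBμ0 hBμ' J τ''
  have hNd := prescribedInput_sectorPreimage_of_coarseSizes hβ F (G - G') child hρc Bν hBν0 hBν J τ''
  have hNd' : ∀ (m' : ℕ) (T : Finset (Fin (m + 1))), T ⊆ J → ∀ (ι : T → Fin (2 * m')), Function.Injective ι →
      ∀ (t : Fin (2 * m')), (∀ j, ι j ≠ t) → ∀ a : SpaceTimeIdx L M × SectorLeg N,
        ∑ Y ∈ univ.filter (fun Y : Fin (2 * m') → SpaceTimeIdx L M × SectorLeg N => Y t = a),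
          ‖kernel ℂ (sectorPreimage β F G - sectorPreimage β F G') (2 * m') Y‖ *
            ∏ j : T, (if A j (Y (ι j)) = true then (1 : ℝ) else 0) ≤ Nν m' T.card := by
    intro m' T hT ι hι t ht a
    rw [← sectorPreimage_sub']
    exact hNd m' T hT ι hι t ht a
  -- the inherited predicates: a fine label only overlaps its parents
  have hPA : ∀ j ∈ J, ∀ (y'' : SpaceTimeIdx L M × SectorLeg N') (x' : SpaceTimeIdx L M × SectorLeg N),
      (fun (j : Fin (m + 1)) (X'' : SpaceTimeIdx L M × SectorLeg N') => X''.2 = τ'' j) j y'' →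
        (LinearMap.toMatrix' (Matrix.toLin' (sectorAnalysisMatrix L M β F')) *
            LinearMap.toMatrix' (Matrix.toLin' (sectorSubMatrix L M β Ft))) y'' x' ≠ 0 → A j x' = true := by
    intro j _ y'' x' hPj hne
    rw [LinearMap.toMatrix'_toLin', LinearMap.toMatrix'_toLin'] at hne
    obtain ⟨h1, h2, h3⟩ := hvan y'' x' hne
    have hPj' : y''.2 = τ'' j := hPj
    simp only [hA, decide_eq_true_eq, mem_filter, mem_univ, true_and, ← hPj']
    exact ⟨h1, h2, h3⟩
  -- transfer from `map S Ṽ` to `G` (plateau identities), both inputs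
  have hea := map_sectorAnalysis_effAction_map_sectorPreimage_of_plateau hβ.ne' F Ft hFF hF0 F' G C hCpl hF'pl
  have hgc := map_sectorAnalysis_gaussConv_map_sectorPreimage_of_plateau hβ.ne' F Ft hFF hF0 F' G C hCpl hF'pl
  have hea' := map_sectorAnalysis_effAction_map_sectorPreimage_of_plateau hβ.ne' F Ft hFF hF0 F' G' C hCpl hF'pl
  have hgc' := map_sectorAnalysis_gaussConv_map_sectorPreimage_of_plateau hβ.ne' F Ft hFF hF0 F' G' C hCpl hF'pl
  have hrepl : ExteriorAlgebra.map (Matrix.toLin' (sectorAnalysisMatrix L M β F'))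
      ((effAction ℂ C G - gaussConv ℂ C G) - (effAction ℂ C G' - gaussConv ℂ C G')) =
      ExteriorAlgebra.map (Matrix.toLin' (sectorAnalysisMatrix L M β F'))
        ((effAction ℂ C (ExteriorAlgebra.map (Matrix.toLin' (sectorSubMatrix L M β Ft)) (sectorPreimage β F G)) -
            gaussConv ℂ C (ExteriorAlgebra.map (Matrix.toLin' (sectorSubMatrix L M β Ft)) (sectorPreimage β F G))) -
          (effAction ℂ C (ExteriorAlgebra.map (Matrix.toLin' (sectorSubMatrix L M β Ft)) (sectorPreimage β F G')) -
            gaussConv ℂ C (ExteriorAlgebra.map (Matrix.toLin' (sectorSubMatrix L M β Ft)) (sectorPreimage β F G')))) := by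
    simp only [map_sub, hea, hgc, hea', hgc']
  rw [hrepl]
  exact sum_filter_norm_kernel_map_effAction_sub_gaussConv_sub_le_graded_prescribed_of_gramBounded C
    (Matrix.toLin' (sectorSubMatrix L M β Ft)) (Matrix.toLin' (sectorAnalysisMatrix L M β F')) (sectorPreimage β F G) (sectorPreimage β F G')
    (sectorPreimage_mem_evenPart β F hG) (sectorPreimage_mem_evenPart β F hG') (by rw [constPart_sectorPreimage, hG0])
    (by rw [constPart_sectorPreimage, hG'0]) hκ (by simpa only [LinearMap.toMatrix'_toLin'] using hGB)
    p J hp (fun j X'' => X''.2 = τ'' j) A hPA Nμ Nν hNμ0 hNν0 hNG hNG' hNd' hα (by simpa only [LinearMap.toMatrix'_toLin'] using hrow)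
    (by simpa only [LinearMap.toMatrix'_toLin'] using hcol) hρ hθ hcc0 (by simpa only [LinearMap.toMatrix'_toLin'] using hrow')
    (by simpa only [LinearMap.toMatrix'_toLin'] using hcol') hN₀ w''

end Transfer

end Literature.MathematicalPhysics.QuantumLattice

end
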